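import Mathlib
import HarnessLib

/-!
# Item `BarrierLever.NaturalProofsSeparateVNP` (stmt-ValiantsHypothesis-18972), SIGN SLICE —
# part 2: a small modulus not dividing a nonzero integer of bounded size (Chinese remaindering)

Support file for the unconditional SIGN-SLICE form of the item (CKRST 2020, Thm. 1.1, tree frame).
CKRST's Claim 13 ("if `0 ≠ |f(a)| ≤ M` then `f(a) ≢ 0 (mod r)` for some prime `r ≤ O(log² M)`,
by the prime number theorem / Chinese Remainder Theorem) is replaced by an elementary variant with
ALL moduli `r ∈ [2, 2m]`: if every such `r` divides `x` then the central binomial coefficient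
`binom(2m, m)` divides `x` (each prime power in `binom(2m, m)` is `≤ 2m`, Mathlib
`Nat.pow_factorization_choose_le`), and `binom(2m, m) ≥ 2^m`. Hence:

* `CRT.exists_not_dvd_of_lt_two_pow` — `0 < x < 2^m` ⇒ some `r ∈ [2, 2m]` does not divide `x`;
* `CRT.exists_not_dvd_int` — the same for a nonzero integer with `|x| < 2^m`.

References: [ChatterjeeKumarRamyaSaptharishiTengse2020] Claim 13 (p. 11); Mathlib
`Nat.four_pow_le_two_mul_self_mul_centralBinom` (Erdős's bound from the proof of Bertrand's postulate).
-/

-- layout Summits/ValiantsHypothesis/ValiantsHypothesis forces the duplicated namespace component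
set_option linter.dupNamespace false

namespace Summit.ValiantsHypothesis.ValiantsHypothesis.Theorems.BarrierLever.NaturalProofsSeparateVNP

namespace CRT

/-- `2^m ≤ binom(2m, m)` (from Erdős's `4^m ≤ 2m · binom(2m, m)` and `2m ≤ 2^m`). [folklore] -/
theorem two_pow_le_centralBinom (m : ℕ) : 2 ^ m ≤ Nat.centralBinom m := by
  rcases Nat.eq_zero_or_pos m with rfl | hm
  · simp [Nat.centralBinom]
  have h4 := Nat.four_pow_le_two_mul_self_mul_centralBinom m hm
  have h2m : 2 * m ≤ 2 ^ m := by
    have : m < 2 ^ m := Nat.lt_two_pow_self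
    have h1 : 1 ≤ m := hm
    calc 2 * m ≤ 2 * 2 ^ (m - 1) := by
          have : m ≤ 2 ^ (m - 1) := by
            have := @Nat.lt_two_pow_self (m - 1)
            omega
          omega
      _ = 2 ^ m := by rw [← pow_succ']; congr 1; omega
  have h44 : (4 : ℕ) ^ m = 2 ^ m * 2 ^ m := by
    rw [← mul_pow]; norm_num
  by_contra hlt
  push Not at hlt
  have : 2 * m * Nat.centralBinom m < 2 ^ m * 2 ^ m :=
    calc 2 * m * Nat.centralBinom m < 2 * m * 2 ^ m + 1 := by
          have := Nat.mul_le_mul_left (2 * m) hlt.le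
          omega
      _ ≤ 2 ^ m * 2 ^ m := by
          rcases Nat.lt_or_ge (2 * m * Nat.centralBinom m) (2 * m * 2 ^ m) with h | h
          · nlinarith [Nat.centralBinom_pos m]
          · nlinarith [Nat.centralBinom_pos m, Nat.mul_lt_mul_of_pos_left hlt (by omega : 0 < 2 * m)]
  omega

/-- If every `r ∈ [2, 2m]` divides `x`, then `binom(2m, m) ∣ x`: every prime power `p^e` exactly
dividing `binom(2m, m)` satisfies `p^e ≤ 2m`. [cite: ChatterjeeKumarRamyaSaptharishiTengse2020, Claim 13] -/
theorem centralBinom_dvd_of_forall_dvd {x m : ℕ} (h : ∀ r : ℕ, 2 ≤ r → r ≤ 2 * m → r ∣ x) :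
    Nat.centralBinom m ∣ x := by
  rcases Nat.eq_zero_or_pos x with rfl | hx
  · exact dvd_zero _
  rcases Nat.eq_zero_or_pos m with rfl | hm
  · simp [Nat.centralBinom]
  have hC : Nat.centralBinom m ≠ 0 := (Nat.centralBinom_pos m).ne'
  rw [← Nat.factorization_le_iff_dvd hC hx.ne']
  intro q
  by_cases hq : q.Prime
  · set e := (Nat.centralBinom m).factorization q with he
    rcases Nat.eq_zero_or_pos e with h0 | hepos
    · rw [h0]; exact Nat.zero_le _
    have hle : q ^ e ≤ 2 * m := by
      rw [he, Nat.centralBinom_eq_two_mul_choose]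
      exact Nat.pow_factorization_choose_le (by omega)
    have hge : 2 ≤ q ^ e :=
      le_trans hq.two_le (Nat.le_self_pow hepos.ne' q)
    have hdvd : q ^ e ∣ x := h _ hge hle
    exact (hq.pow_dvd_iff_le_factorization hx.ne').mp hdvd
  · rw [Nat.factorization_eq_zero_of_not_prime _ hq]; exact Nat.zero_le _

/-- **Small non-divisor.** If `0 < x < 2^m` then some `r` with `2 ≤ r ≤ 2m` does not divide `x`.
[cite: ChatterjeeKumarRamyaSaptharishiTengse2020, Claim 13] -/
theorem exists_not_dvd_of_lt_two_pow {x m : ℕ} (hx0 : x ≠ 0) (hx : x < 2 ^ m) :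
    ∃ r : ℕ, 2 ≤ r ∧ r ≤ 2 * m ∧ ¬ r ∣ x := by
  by_contra hcon
  push Not at hcon
  have hdvd : Nat.centralBinom m ∣ x :=
    centralBinom_dvd_of_forall_dvd fun r h2 h2m => hcon r h2 h2m
  have hle : Nat.centralBinom m ≤ x := Nat.le_of_dvd (Nat.pos_of_ne_zero hx0) hdvd
  have := two_pow_le_centralBinom m
  omega

/-- **Small non-divisor, integer form.** If `x ≠ 0` and `|x| < 2^m` then some `r` with
`2 ≤ r ≤ 2m` does not divide `x`. [cite: ChatterjeeKumarRamyaSaptharishiTengse2020, Claim 13] -/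
theorem exists_not_dvd_int {x : ℤ} {m : ℕ} (hx0 : x ≠ 0) (hx : x.natAbs < 2 ^ m) :
    ∃ r : ℕ, 2 ≤ r ∧ r ≤ 2 * m ∧ ¬ (r : ℤ) ∣ x := by
  obtain ⟨r, h2, h2m, hr⟩ :=
    exists_not_dvd_of_lt_two_pow (Int.natAbs_ne_zero.mpr hx0) hx
  exact ⟨r, h2, h2m, fun hd => hr (Int.natCast_dvd.mp hd)⟩

end CRT

end Summit.ValiantsHypothesis.ValiantsHypothesis.Theorems.BarrierLever.NaturalProofsSeparateVNP
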